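import Mathlib.RingTheory.MvPolynomial.WeightedHomogeneous
import Mathlib.RingTheory.MvPolynomial.Basic
import Mathlib.RingTheory.Ideal.Operations
import Mathlib.Algebra.BigOperators.Fin
import HarnessLib

/-!
# Veronese splitting for the weights `(10,15,45,18)` and `N = 90` — idea-1's control specimen `g + w⁵` (matrix row 13)
# (crux `FInjectiveMacaulayfication`, line `graded-engine` §17 filtered engine, calibration G6h)

Support file for crux stmt-ResolutionOfSingularities-15315 (`FrobeniusLadder.FInjectiveMacaulayfication`), chain w45a,
seat res-L1-w45a-stub-3. [OURS · L1 W4.5a; idea-1 r2 TEST MATRIX row 13] — NOT a statement of the manuscript; AI-written, weaker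
than expert review.

The Veronese-saturation hypothesis `hpow` of the weighted / graded / filtered blow-up engines for idea-1's control threefold point
`f = z² + (y² + x³)³ + x¹⁰ + w⁵` (`p = 7`; variables `X₀ = x, X₁ = y, X₂ = z, X₃ = w`, weights `w = (10, 15, 45, 18)`, initial form of
weight `90`, `N = 90 = lcm`, `c = (9, 6, 2, 5)`): **every monomial of weighted degree `≥ 90K` lies in `I₉₀^K`.**

Proof (`coord_split`): peel a block of weight exactly `90` — `x⁹`, `y⁶`, `z²`, `w⁵`, `x⁶y²`, `x³y⁴`, `y³z`, `x³yz` — whenever one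
divides; otherwise the exponent box is so small that `K ≤ 1`, and the only vectors of weight `≥ 180` left are `x⁷zw⁴`, `x⁸zw⁴`
(weights `187`, `197`), where `x⁵z` (weight `95`) peels with cofactor of weight `≥ 92`. Linear arithmetic (`omega`) certifies every
branch. Template: `BP237VeroneseSplitting` (p465729). [folklore]
-/

-- single-problem summit: the doubled namespace component is forced
set_option linter.dupNamespace false

namespace Summit.ResolutionOfSingularities.ResolutionOfSingularities.Theorems.FInjectiveMacaulayfication.G5wVeronese

/-- **Coordinate splitting** for `w = (10,15,45,18)`, `N = 90`: if `(K+1)·90 ≤ 10a₀ + 15a₁ + 45a₂ + 18a₃` then `a = b + c` with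
`90 ≤ w·b` and `K·90 ≤ w·c`. [folklore] -/
theorem coord_split (K a₀ a₁ a₂ a₃ : ℕ) (h : (K + 1) * 90 ≤ 10 * a₀ + 15 * a₁ + 45 * a₂ + 18 * a₃) :
    ∃ b₀ b₁ b₂ b₃ c₀ c₁ c₂ c₃ : ℕ, a₀ = b₀ + c₀ ∧ a₁ = b₁ + c₁ ∧ a₂ = b₂ + c₂ ∧ a₃ = b₃ + c₃ ∧
      90 ≤ 10 * b₀ + 15 * b₁ + 45 * b₂ + 18 * b₃ ∧ K * 90 ≤ 10 * c₀ + 15 * c₁ + 45 * c₂ + 18 * c₃ := by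
  -- pure blocks of weight exactly `90`
  by_cases h₀ : 9 ≤ a₀
  · exact ⟨9, 0, 0, 0, a₀ - 9, a₁, a₂, a₃, by omega⟩
  by_cases h₁ : 6 ≤ a₁
  · exact ⟨0, 6, 0, 0, a₀, a₁ - 6, a₂, a₃, by omega⟩
  by_cases h₂ : 2 ≤ a₂
  · exact ⟨0, 0, 2, 0, a₀, a₁, a₂ - 2, a₃, by omega⟩
  by_cases h₃ : 5 ≤ a₃
  · exact ⟨0, 0, 0, 5, a₀, a₁, a₂, a₃ - 5, by omega⟩
  -- mixed blocks of weight exactly `90`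
  by_cases h₄ : 6 ≤ a₀ ∧ 2 ≤ a₁
  · exact ⟨6, 2, 0, 0, a₀ - 6, a₁ - 2, a₂, a₃, by omega⟩
  by_cases h₅ : 3 ≤ a₀ ∧ 4 ≤ a₁
  · exact ⟨3, 4, 0, 0, a₀ - 3, a₁ - 4, a₂, a₃, by omega⟩
  by_cases h₆ : 3 ≤ a₁ ∧ 1 ≤ a₂
  · exact ⟨0, 3, 1, 0, a₀, a₁ - 3, a₂ - 1, a₃, by omega⟩
  by_cases h₇ : 3 ≤ a₀ ∧ 1 ≤ a₁ ∧ 1 ≤ a₂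
  · exact ⟨3, 1, 1, 0, a₀ - 3, a₁ - 1, a₂ - 1, a₃, by omega⟩
  -- the residual box: `K ≤ 1`, and for `K = 1` only `x⁷zw⁴`, `x⁸zw⁴` remain — peel `x⁵z` (weight `95`)
  by_cases h₈ : 5 ≤ a₀ ∧ 1 ≤ a₂ ∧ 4 ≤ a₃
  · exact ⟨5, 0, 1, 0, a₀ - 5, a₁, a₂ - 1, a₃, by omega⟩
  exact ⟨a₀, a₁, a₂, a₃, 0, 0, 0, 0, by omega⟩

/-- The `(10,15,45,18)`-weighted degree in coordinates. [folklore] -/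
theorem weight_eq (f : Fin 4 →₀ ℕ) :
    Finsupp.weight (![10, 15, 45, 18] : Fin 4 → ℕ) f = 10 * f 0 + 15 * f 1 + 45 * f 2 + 18 * f 3 := by
  rw [Finsupp.weight_apply,
    Finsupp.sum_fintype f (fun i c => c • (![10, 15, 45, 18] : Fin 4 → ℕ) i) (fun _ => zero_smul ℕ _),
    Fin.sum_univ_four]
  simp only [smul_eq_mul, Matrix.cons_val_zero, Matrix.cons_val_one, Matrix.cons_val]
  ring

/-- **Exponent-vector splitting** (`coord_split` along `Finsupp.equivFunOnFinite`). [folklore] -/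
theorem finsupp_split (K : ℕ) (a : Fin 4 →₀ ℕ)
    (ha : (K + 1) * 90 ≤ Finsupp.weight (![10, 15, 45, 18] : Fin 4 → ℕ) a) :
    ∃ b c : Fin 4 →₀ ℕ, a = b + c ∧ 90 ≤ Finsupp.weight (![10, 15, 45, 18] : Fin 4 → ℕ) b ∧
      K * 90 ≤ Finsupp.weight (![10, 15, 45, 18] : Fin 4 → ℕ) c := by
  rw [weight_eq] at ha
  obtain ⟨b₀, b₁, b₂, b₃, c₀, c₁, c₂, c₃, e₀, e₁, e₂, e₃, hb, hc⟩ := coord_split K (a 0) (a 1) (a 2) (a 3) ha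
  refine ⟨Finsupp.equivFunOnFinite.symm ![b₀, b₁, b₂, b₃], Finsupp.equivFunOnFinite.symm ![c₀, c₁, c₂, c₃],
    ?_, ?_, ?_⟩
  · ext i
    fin_cases i <;> simp [e₀, e₁, e₂, e₃]
  · rw [weight_eq]
    simpa using hb
  · rw [weight_eq]
    simpa using hc

/-- **VERONESE SPLITTING for `w = (10,15,45,18)`, `N = 90`**: every monomial of weighted degree `≥ 90K` lies in `I₉₀^K`.
[folklore] -/
theorem g5wVeroneseSplitting : ∀ (k : Type) [Field k] (K : ℕ) (b : Fin 4 →₀ ℕ),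
    K * 90 ≤ Finsupp.weight (![10, 15, 45, 18] : Fin 4 → ℕ) b →
    (MvPolynomial.monomial b (1 : k) : MvPolynomial (Fin 4) k) ∈
      (Ideal.span {m : MvPolynomial (Fin 4) k | ∃ b : Fin 4 →₀ ℕ,
        90 ≤ Finsupp.weight (![10, 15, 45, 18] : Fin 4 → ℕ) b ∧ m = MvPolynomial.monomial b 1}) ^ K := by
  intro k _ K
  induction K with
  | zero =>
    intro a _
    rw [pow_zero, Ideal.one_eq_top]
    exact Submodule.mem_top
  | succ K ih =>
    intro a ha
    obtain ⟨b, c, rfl, hb, hc⟩ := finsupp_split K a ha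
    have hmul : (MvPolynomial.monomial (b + c) (1 : k) : MvPolynomial (Fin 4) k) =
        MvPolynomial.monomial b 1 * MvPolynomial.monomial c 1 := by
      rw [MvPolynomial.monomial_mul, one_mul]
    rw [pow_succ', hmul]
    exact Ideal.mul_mem_mul (Ideal.subset_span ⟨b, hb, rfl⟩) (ih c hc)

end Summit.ResolutionOfSingularities.ResolutionOfSingularities.Theorems.FInjectiveMacaulayfication.G5wVeronese
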